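import Literature.Probability.LatticeModels.TorusTwoPointDecay
import Literature.Probability.LatticeModels.TorusTransferSpectral
import Literature.Probability.LatticeModels.GaussianDominationProofs
import Literature.Probability.LatticeModels.CriticalTwoPointLower
import Literature.Probability.LatticeModels.GibbsStatesProofs
import Mathlib.Analysis.Normed.Group.Tannery
import HarnessLib

/-!
# The Fourier transform of the subcritical two-point function as the infinite-volume limit of the torus

Topic `Literature/Probability/LatticeModels`; family `crit-ising`. No named fact, no sorry; the
definitions are `phase` (`p · x`), `twoPointPlusFourier` (the object `Ŝ_β` of ADC §5.2), the centred
representatives of the torus (`centredCube`, `Torus.rep`) and the lattice approximants of a momentum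
(`reduceMomentum`, `momentumIndex`, `approxMomentum`).

## What is proved

For the nearest-neighbour ferromagnetic Ising model on `ℤ^d`, `d ≥ 2`, at `0 ≤ β < β_c`, with
`S(x) = ⟨σ₀σ_x⟩⁺_{β,0}` (`twoPointPlus`; the unique state below `β_c`) and
`Ŝ_β(p) = ∑_{x ∈ ℤ^d} S(x) cos(p·x)` (`twoPointPlusFourier`, absolutely convergent by sharpness):

* `summable_twoPointPlus_of_lt_criticalBeta`, `continuous_twoPointPlusFourier`, evenness in each
  coordinate (`twoPointPlusFourier_update_neg`) and `2π`-periodicity;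
* `tendsto_twoPointFourierTorus_re` — **ADC 2021, Prop. 5.2, third item**: along any tori
  `N_j → ∞` and lattice momenta `2πk_j/N_j → p`, `Re Ĝ_{N_j}(k_j) → Ŝ_β(p)` (dominated convergence
  over `ℤ^d`: pointwise convergence of the periodic two-point function, `TorusTwoPointLimit`, and the
  uniform exponential decay, `TorusTwoPointDecay`);
* `twoPointPlusFourier_nonneg` — `Ŝ_β ≥ 0`;
* `twoPointPlusFourier_le_infrared` — **the infrared bound in infinite volume**, ADC (5.12):
  `Ŝ_β(p) ≤ 1/(2β ∑ᵢ(1 - cos pᵢ))` for `0 < β < β_c`, `p ∉ 2πℤ^d` (limit of `infraredBound_holds`);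
* `twoPointPlusFourier_update_le_of_cos_le` — **ADC Prop. 5.4 (i)**: `Ŝ_β` is decreasing in each
  `|p_i|`; `one_sub_cos_mul_twoPointPlusFourier_le` — **ADC Prop. 5.4 (ii)**: `(1 - cos p_i) Ŝ_β(p)`
  is increasing in `|p_i|` (limits of the exact torus statements of `TorusTransferSpectral`).

These are the infinite-volume inputs (apart from the diagonal monotonicity, Prop. 5.4 third item /
Cor. 5.5, which needs the rotated torus) of ADC's sliding-scale infrared bound, Thm 5.6
(`aizenmanDuminilCopin_slidingScaleInfraredBound`), step V3 of the tree's programme towards it. The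
torus-dependent statements are given in dimension `d' + 1` with `1 ≤ d'` (the form of
`TorusTransferSpectral`); for `d ≥ 2` substitute `d = d' + 1`.

## References

* M. Aizenman, H. Duminil-Copin, Ann. of Math. 194 (2021) = arXiv:1912.07973, §5.2 (5.11)–(5.12),
  Prop. 5.2, Prop. 5.4 (i),(ii) [AizenmanDuminilCopinAnnals2021].
* R. Panis, arXiv:2309.05797, Thm 3.13, Cor. 3.15 [Panis2023Triviality].
* J. Fröhlich, B. Simon, T. Spencer, Comm. Math. Phys. 50 (1976), Thm 3.1 [FrohlichSimonSpencer1976].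

## Mathlib

`tendsto_tsum_of_dominated_convergence` (Tannery), `continuous_tsum`, `summable_of_sum_le`, `Equiv.tsum_eq`,
`Real.cos_add_int_mul_two_pi`, `Real.cos_eq_cos_iff`, `Int.sub_floor_div_mul_nonneg/lt`,
`Filter.Tendsto.eventually_lt`, `le_of_tendsto_of_tendsto`.
-/

noncomputable section

open MeasureTheory Filter Topology Finset

namespace Literature.Probability.LatticeModels

variable {d : ℕ}

/-! ### Part 1. The subcritical two-point function and its Fourier transform -/

section Defs

variable (d) in
/-- The momentum phase `p · x = ∑ᵢ pᵢ xᵢ` for `p ∈ ℝ^d`, `x ∈ ℤ^d`. [folklore] -/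
def phase (p : Fin d → ℝ) (x : Site d) : ℝ := ∑ i, p i * (x i : ℝ)

variable (d) in
/-- **The Fourier transform of the infinite-volume two-point function**
`Ŝ_β(p) = ∑_{x ∈ ℤ^d} ⟨σ₀σ_x⟩_β cos(p · x)` (Aizenman–Duminil-Copin 2021, §5.2, (5.11):
`Ŝ_{ρ,β}(p) := ∑_x e^{ip·x} S_{ρ,β}(x)`, real by the symmetry `S(-x) = S(x)`; here `S = ⟨σ₀σ_x⟩⁺_{β,0}`,
the state being unique below `β_c`), as a real `tsum` (absolutely convergent for `β < β_c`, junk `0`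
otherwise). [cite: AizenmanDuminilCopinAnnals2021, arXiv:1912.07973 §5.2 eq. (5.11) (p. 16–17)] -/
def twoPointPlusFourier (β : ℝ) (p : Fin d → ℝ) : ℝ :=
  ∑' x : Site d, twoPointPlus d β x * Real.cos (phase d p x)

/-- `p · (-x) = -(p · x)`. [folklore] -/
theorem phase_neg (p : Fin d → ℝ) (x : Site d) : phase d p (-x) = -phase d p x := by
  simp [phase, Finset.sum_neg_distrib, mul_neg]

/-- `p · (x + y) = p · x + p · y`. [folklore] -/
theorem phase_add (p : Fin d → ℝ) (x y : Site d) : phase d p (x + y) = phase d p x + phase d p y := by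
  simp [phase, mul_add, Finset.sum_add_distrib]

/-- **Summability below `β_c`**: for `d ≥ 2` and `0 ≤ β < β_c`, `∑_x ⟨σ₀σ_x⟩⁺_β < ∞` (sharpness:
exponential decay of the free two-point function, `twoPoint_exponentialDecay_of_lt_criticalBeta_holds`,
and `⟨·⟩⁺ = ⟨·⟩^∅` since `m*(β) = 0`). [cite: AizenmanBarskyFernandez1987, Thm. 1] -/
theorem summable_twoPointPlus_of_lt_criticalBeta (hd : 2 ≤ d) {β : ℝ} (hβ : 0 ≤ β)
    (hβc : β < criticalBeta d) : Summable (twoPointPlus d β) := by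
  obtain ⟨c, hc, hdec⟩ := twoPoint_exponentialDecay_of_lt_criticalBeta_holds (d := d) hd hβ hβc
  obtain ⟨B, hB⟩ := sum_box_exp_neg_mul_norm_le (d := d) hc
  have hm : spontaneousMagnetization d β = 0 := spontaneousMagnetization_eq_zero_of_lt_criticalBeta_holds hβ hβc
  have heq : ∀ x, twoPointPlus d β x = twoPointFree d β x := fun x =>
    (twoPointFree_eq_twoPointPlus_of_spontaneousMagnetization_eq_zero hβ hm x).symm
  have h0 : ∀ x, 0 ≤ twoPointPlus d β x := fun x => twoPointPlus_nonneg_of_gks hβ x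
  -- uniform box bounds give summability (every finite set lies in a box)
  refine summable_of_sum_le (c := B) h0 fun s => ?_
  obtain ⟨N, hN⟩ := exists_forall_subset_box d s
  refine (Finset.sum_le_sum_of_subset_of_nonneg (hN N le_rfl) fun x _ _ => h0 x).trans ?_
  calc ∑ x ∈ box d N, twoPointPlus d β x ≤ ∑ x ∈ box d N, Real.exp (-c * ‖x‖) :=
        Finset.sum_le_sum fun x _ => by rw [heq]; exact hdec x
    _ ≤ B := hB N

/-- The Fourier series converges absolutely below `β_c`. [folklore] -/
theorem summable_twoPointPlus_mul_cos (hd : 2 ≤ d) {β : ℝ} (hβ : 0 ≤ β) (hβc : β < criticalBeta d)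
    (p : Fin d → ℝ) : Summable fun x : Site d => twoPointPlus d β x * Real.cos (phase d p x) := by
  refine (summable_twoPointPlus_of_lt_criticalBeta hd hβ hβc).of_norm_bounded (fun x => ?_)
  rw [Real.norm_eq_abs, abs_mul, abs_of_nonneg (twoPointPlus_nonneg_of_gks hβ x)]
  exact mul_le_of_le_one_right (twoPointPlus_nonneg_of_gks hβ x) (Real.abs_cos_le_one _)

end Defs

/-! ### Part 2. Symmetries and continuity of `Ŝ_β` -/

section Symmetry

/-- `⟨σ₀σ_{gx}⟩⁺ = ⟨σ₀σ_x⟩⁺` for a signed coordinate permutation `g`, so the Fourier transform is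
invariant: `Ŝ(p ∘ g) = Ŝ(p)` in the corresponding sense. Here: **evenness in each coordinate**,
`Ŝ(p₁,…,-p_j,…,p_d) = Ŝ(p)` (Aizenman–Duminil-Copin 2021, proof of Prop. 5.4: "the symmetries of
`Ŝ_{ρ,β}`"). [cite: AizenmanDuminilCopinAnnals2021, arXiv:1912.07973 proof of Thm 5.6 ("Using the symmetries of Ŝ")] -/
theorem twoPointPlusFourier_update_neg (β : ℝ) (p : Fin d → ℝ) (j : Fin d) :
    twoPointPlusFourier d β (Function.update p j (-p j)) = twoPointPlusFourier d β p := by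
  classical
  unfold twoPointPlusFourier
  -- reindex by the coordinate reflection `x ↦ (xᵢ, -x_j)`
  set g : Site d ≃ Site d := Site.signedPerm (Equiv.refl _) (Function.update 1 j (-1)) with hg
  rw [← Equiv.tsum_eq g]
  refine tsum_congr fun x => ?_
  have hS : twoPointPlus d β (g x) = twoPointPlus d β x := twoPointPlus_signedPerm β _ _ x
  have hph : phase d (Function.update p j (-p j)) (g x) = phase d p x := by
    unfold phase
    refine Finset.sum_congr rfl fun i _ => ?_
    rw [hg, Site.signedPerm_apply, Equiv.refl_symm, Equiv.refl_apply]
    by_cases hij : i = j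
    · subst hij
      simp
    · simp [Function.update_of_ne hij]
  rw [hS, hph]

/-- **Periodicity**: `Ŝ(p + 2π m e_j) = Ŝ(p)` for `m ∈ ℤ`. [folklore] -/
theorem twoPointPlusFourier_update_add_int_mul (β : ℝ) (p : Fin d → ℝ) (j : Fin d) (m : ℤ) :
    twoPointPlusFourier d β (Function.update p j (p j + m * (2 * Real.pi))) = twoPointPlusFourier d β p := by
  classical
  unfold twoPointPlusFourier
  refine tsum_congr fun x => ?_
  congr 1
  have : phase d (Function.update p j (p j + m * (2 * Real.pi))) x = phase d p x + ((m * x j : ℤ) : ℝ) * (2 * Real.pi) := by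
    unfold phase
    rw [← Finset.add_sum_erase _ _ (Finset.mem_univ j), ← Finset.add_sum_erase _ (fun i => p i * (x i : ℝ)) (Finset.mem_univ j),
      Function.update_self]
    have : ∑ i ∈ Finset.univ.erase j, Function.update p j (p j + m * (2 * Real.pi)) i * (x i : ℝ) =
        ∑ i ∈ Finset.univ.erase j, p i * (x i : ℝ) :=
      Finset.sum_congr rfl fun i hi => by rw [Function.update_of_ne (Finset.ne_of_mem_erase hi)]
    rw [this]
    push_cast
    ring
  rw [this, Real.cos_add_int_mul_two_pi]

/-- **Evenness of the two-point function**: `⟨σ₀σ_{-x}⟩⁺ = ⟨σ₀σ_x⟩⁺`. [folklore] -/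
theorem twoPointPlus_neg (β : ℝ) (x : Site d) : twoPointPlus d β (-x) = twoPointPlus d β x := by
  have := twoPointPlus_signedPerm β (Equiv.refl _) (fun _ => -1) x
  convert this using 2
  funext i
  simp

/-- **Continuity of `Ŝ_β`** below `β_c` (uniformly convergent Fourier series). [folklore] -/
theorem continuous_twoPointPlusFourier (hd : 2 ≤ d) {β : ℝ} (hβ : 0 ≤ β) (hβc : β < criticalBeta d) :
    Continuous (twoPointPlusFourier d β) := by
  unfold twoPointPlusFourier
  refine continuous_tsum (fun x => ?_) (summable_twoPointPlus_of_lt_criticalBeta hd hβ hβc) (fun x p => ?_)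
  · unfold phase
    fun_prop
  · rw [Real.norm_eq_abs, abs_mul, abs_of_nonneg (twoPointPlus_nonneg_of_gks hβ x)]
    exact mul_le_of_le_one_right (twoPointPlus_nonneg_of_gks hβ x) (Real.abs_cos_le_one _)

end Symmetry

/-! ### Part 3. The torus Fourier transform through centred representatives -/

section TorusRep

variable {N : ℕ} [NeZero N]

/-- The **centred cube** of representatives of `(ℤ/Nℤ)^d`: `C_N = {x : -N < 2xᵢ ≤ N}`. [folklore] -/
def centredCube (d N : ℕ) : Finset (Site d) :=
  (box d N).filter fun x => ∀ i, -(N : ℤ) < 2 * x i ∧ 2 * x i ≤ N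

omit [NeZero N] in
/-- Membership in the centred cube. [folklore] -/
theorem mem_centredCube {x : Site d} : x ∈ centredCube d N ↔ ∀ i, -(N : ℤ) < 2 * x i ∧ 2 * x i ≤ N := by
  rw [centredCube, Finset.mem_filter, mem_box]
  constructor
  · exact fun h => h.2
  · intro h
    exact ⟨fun i => by have := h i; omega, h⟩

omit [NeZero N] in
/-- Points of the centred cube have `2‖x‖_∞ ≤ N`. [folklore] -/
theorem two_mul_supNorm_le_of_mem_centredCube {x : Site d} (hx : x ∈ centredCube d N) : 2 * Site.supNorm x ≤ N := by
  rw [mem_centredCube] at hx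
  unfold Site.supNorm
  have hb : ∀ i, (x i).natAbs ≤ N / 2 := fun i => by have := hx i; omega
  have : Finset.univ.sup (fun i => (x i).natAbs) ≤ N / 2 := Finset.sup_le fun i _ => hb i
  omega

/-- The **centred representative** of `u ∈ (ℤ/Nℤ)^d`. [folklore] -/
def Torus.rep (u : TorusSite d N) : Site d := fun i => if 2 * (u i).val ≤ N then ((u i).val : ℤ) else ((u i).val : ℤ) - N

/-- The centred representative lies in the centred cube. [folklore] -/
theorem Torus.rep_mem_centredCube (u : TorusSite d N) : Torus.rep u ∈ centredCube d N := by
  rw [mem_centredCube]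
  intro i
  unfold Torus.rep
  have := ZMod.val_lt (u i)
  have hN : 0 < N := Nat.pos_of_ne_zero (NeZero.ne N)
  split_ifs with h <;> constructor <;> omega

/-- The centred representative projects back. [folklore] -/
theorem Torus.proj_rep (u : TorusSite d N) : Torus.proj N (Torus.rep u) = u := by
  funext i
  rw [Torus.proj_apply]
  unfold Torus.rep
  split_ifs with h
  · simp
  · push_cast
    simp

/-- A point of the centred cube is the representative of its projection. [folklore] -/
theorem Torus.rep_proj {x : Site d} (hx : x ∈ centredCube d N) : Torus.rep (Torus.proj N x) = x := by
  rw [mem_centredCube] at hx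
  funext i
  have hxi := hx i
  have hv : (((x i : ZMod N).val : ℕ) : ℤ) = x i % N := ZMod.val_intCast (x i)
  have hlt := ZMod.val_lt ((x i : ℤ) : ZMod N)
  have hN : (0 : ℤ) < N := by exact_mod_cast Nat.pos_of_ne_zero (NeZero.ne N)
  have h1 : x i % N = x i - N * (x i / N) := Int.emod_def _ _
  have h2 := Int.emod_nonneg (x i) hN.ne'
  have h3 := Int.emod_lt_of_pos (x i) hN
  unfold Torus.rep
  simp only [Torus.proj_apply]
  set v := ((x i : ℤ) : ZMod N).val with hvdef
  set q := x i / N with hq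
  split_ifs with h
  · -- `2v ≤ N`: then `x i = v`
    have h2v : 2 * (v : ℤ) ≤ N := by exact_mod_cast h
    rcases lt_trichotomy q 0 with hq0 | hq0 | hq0
    · have : (N : ℤ) * q ≤ N * (-1) := mul_le_mul_of_nonneg_left (by omega) hN.le
      omega
    · rw [hq0, mul_zero, sub_zero] at h1; omega
    · have : (N : ℤ) * 1 ≤ N * q := mul_le_mul_of_nonneg_left (by omega) hN.le
      omega
  · have h2v : N < 2 * (v : ℤ) := by push Not at h; exact_mod_cast h
    rcases lt_trichotomy q (-1) with hq0 | hq0 | hq0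
    · have : (N : ℤ) * q ≤ N * (-2) := mul_le_mul_of_nonneg_left (by omega) hN.le
      omega
    · rw [hq0] at h1; omega
    · have : (N : ℤ) * 0 ≤ N * q := mul_le_mul_of_nonneg_left (by omega) hN.le
      omega

/-- **Sums over the torus as sums over centred representatives.** [folklore] -/
theorem sum_torus_eq_sum_centredCube {M : Type*} [AddCommMonoid M] (F : TorusSite d N → M) :
    ∑ u, F u = ∑ x ∈ centredCube d N, F (Torus.proj N x) := by
  refine Finset.sum_nbij' Torus.rep (Torus.proj N) (fun u _ => Torus.rep_mem_centredCube u)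
    (fun x _ => Finset.mem_univ _) (fun u _ => Torus.proj_rep u) (fun x hx => Torus.rep_proj hx)
    (fun u _ => by rw [Torus.proj_rep])

/-- The character phase through representatives: for `p = 2πk/N`,
`cos(∑ᵢ pᵢ x̄ᵢ) = cos(p · x)` (`x̄ᵢ ≡ xᵢ mod N`). [folklore] -/
theorem cos_latticeMomentum_val_proj_eq (k : TorusSite d N) (x : Site d) :
    Real.cos (∑ i, latticeMomentum N k i * (((Torus.proj N x i).val : ℕ) : ℝ)) =
      Real.cos (phase d (latticeMomentum N k) x) := by
  have hN : (N : ℝ) ≠ 0 := by exact_mod_cast NeZero.ne N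
  have hdiff : ∀ i, ∃ m : ℤ, latticeMomentum N k i * (((Torus.proj N x i).val : ℕ) : ℝ) =
      latticeMomentum N k i * (x i : ℝ) + m * (2 * Real.pi) := by
    intro i
    have hv : (((Torus.proj N x i).val : ℕ) : ℤ) = x i % N := by rw [Torus.proj_apply]; exact ZMod.val_intCast (x i)
    refine ⟨-((k i).val * (x i / N)), ?_⟩
    have h1 : (x i % N : ℤ) = x i - N * (x i / N) := Int.emod_def _ _
    have hvR : (((Torus.proj N x i).val : ℕ) : ℝ) = (x i : ℝ) - N * ((x i / N : ℤ) : ℝ) := by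
      have : ((((Torus.proj N x i).val : ℕ) : ℤ) : ℝ) = ((x i % N : ℤ) : ℝ) := by rw [hv]
      push_cast at this
      rw [this, h1]
      push_cast
      ring
    rw [hvR, latticeMomentum]
    push_cast
    field_simp
    ring
  choose m hm using hdiff
  unfold phase
  simp only [hm, Finset.sum_add_distrib, ← Finset.sum_mul]
  rw [show (∑ i, (m i : ℝ)) = ((∑ i, m i : ℤ) : ℝ) by push_cast; rfl, Real.cos_add_int_mul_two_pi]

/-- **The real part of the torus Fourier transform through representatives**:
`Re Ĝ_N(k) = ∑_{x ∈ C_N} ⟨σ₀σ_{x̄}⟩_{𝕋_N} cos(p_k · x)`, `p_k = 2πk/N`. [cite: FriedliVelenik2017, §10.4 eq. (10.36)] -/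
theorem twoPointFourierTorus_re_eq_sum_centredCube (β h : ℝ) (k : TorusSite d N) :
    (twoPointFourierTorus (isingTorusMeasure d N β h) k).re =
      ∑ x ∈ centredCube d N, isingTorusTwoPoint d N β h 0 (Torus.proj N x) *
        Real.cos (phase d (latticeMomentum N k) x) := by
  rw [twoPointFourierTorus, torusFourier_eq_sum_torusChar, Complex.re_sum, sum_torus_eq_sum_centredCube]
  refine Finset.sum_congr rfl fun x _ => ?_
  rw [Complex.re_ofReal_mul, Complex.conj_re, torusChar_re, cos_latticeMomentum_val_proj_eq,
    isingTorusTwoPoint_eq_torusTwoPoint, sub_zero]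

end TorusRep

/-! ### Part 4. The infinite-volume limit of the torus Fourier transform -/

section Limit

/-- **Pointwise convergence of the periodic two-point function** (from `TorusTwoPointLimit`, in
`Tendsto` form along any sequence of tori `N_j → ∞`): for `0 ≤ β < β_c`,
`⟨σ₀σ_{x̄}⟩_{𝕋_{N_j};β} → ⟨σ₀σ_x⟩⁺_β`. [cite: AizenmanDuminilCopinAnnals2021, arXiv:1912.07973 Prop. 5.2 (p. 17)] -/
theorem tendsto_isingTorusTwoPoint_proj {β : ℝ} (hβ : 0 ≤ β) (hβc : β < criticalBeta d)
    {Nseq : ℕ → ℕ} [∀ j, NeZero (Nseq j)] (hN : Tendsto Nseq atTop atTop) (x : Site d) :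
    Tendsto (fun j => isingTorusTwoPoint d (Nseq j) β 0 0 (Torus.proj (Nseq j) x)) atTop (𝓝 (twoPointPlus d β x)) := by
  rcases eq_or_ne x 0 with rfl | hx
  · have : ∀ j, isingTorusTwoPoint d (Nseq j) β 0 0 (Torus.proj (Nseq j) 0) = 1 := fun j => by
      rw [show Torus.proj (Nseq j) (0 : Site d) = 0 from (by funext i; simp)]
      simp [isingTorusTwoPoint]
    simp only [this, twoPointPlus_zero]
    exact tendsto_const_nhds
  · have hm : spontaneousMagnetization d β = 0 := spontaneousMagnetization_eq_zero_of_lt_criticalBeta_holds hβ hβc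
    rw [Metric.tendsto_atTop]
    intro ε hε
    obtain ⟨N₀, hN₀⟩ := abs_isingTorusTwoPoint_sub_plusCorr_le_of_spontaneousMagnetization_eq_zero hβ hm
      (x := 0) (y := x) hx.symm (half_pos hε)
    obtain ⟨j₀, hj₀⟩ := eventually_atTop.1 (hN.eventually (eventually_ge_atTop N₀))
    refine ⟨j₀, fun j hj => ?_⟩
    have key := hN₀ (Nseq j) (hj₀ j hj)
    rw [show Torus.proj (Nseq j) (0 : Site d) = 0 from (by funext i; simp)] at key
    rw [Real.dist_eq, twoPointPlus_eq_plusCorr_pair β hx]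
    exact key.trans_lt (half_lt_self hε)

/-- A geometric bound in the sup-norm is dominated by an exponential one:
`θ^{⌊n/L⌋} ≤ θ⁻¹ e^{-(−log θ / L) n}` for `0 < θ < 1`, `L ≥ 1`. [folklore] -/
theorem pow_div_le_inv_mul_exp {θ : ℝ} (hθ0 : 0 < θ) (hθ1 : θ ≤ 1) {L : ℕ} (hL : 1 ≤ L) (n : ℕ) :
    θ ^ (n / L) ≤ θ⁻¹ * Real.exp (-(-Real.log θ / L) * n) := by
  have hLpos : (0 : ℝ) < L := by exact_mod_cast hL
  have hlog : Real.log θ ≤ 0 := Real.log_nonpos hθ0.le hθ1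
  -- `k := n / L ≥ n/L - 1`
  set k : ℕ := n / L with hk
  have hkreal : (n : ℝ) / L - 1 ≤ k := by
    have hdm : (L : ℝ) * k + ((n % L : ℕ) : ℝ) = n := by
      rw [hk]; exact_mod_cast Nat.div_add_mod n L
    have hml : ((n % L : ℕ) : ℝ) + 1 ≤ L := by exact_mod_cast Nat.succ_le_of_lt (Nat.mod_lt n (by omega))
    rw [div_sub_one hLpos.ne', div_le_iff₀ hLpos]
    linarith
  have e1 : θ ^ k = Real.exp (k * Real.log θ) := by rw [Real.exp_nat_mul, Real.exp_log hθ0]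
  have e2 : θ⁻¹ * Real.exp (-(-Real.log θ / L) * (n : ℝ)) = Real.exp (((n : ℝ) / L - 1) * Real.log θ) := by
    rw [← Real.exp_log hθ0, ← Real.exp_neg, ← Real.exp_add, Real.log_exp]
    congr 1
    field_simp
    ring
  rw [e1, e2]
  exact Real.exp_le_exp.2 (by nlinarith)

/-- **The torus Fourier transform converges to `Ŝ_β`** (Aizenman–Duminil-Copin 2021, Prop. 5.2, third
item, for the nearest-neighbour Ising model: for `d ≥ 2`, `0 ≤ β < β_c`, along any sequence of tori
`N_j → ∞` and lattice momenta `k_j ∈ (ℤ/N_jℤ)^d` with `2πk_j/N_j → p`,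
`Re Ĝ_{N_j}(k_j) → Ŝ_β(p) = ∑_x ⟨σ₀σ_x⟩⁺_β cos(p·x)`). Proof: write `Re Ĝ_N(k) = ∑_{x ∈ C_N} ⟨σ₀σ_{x̄}⟩_{𝕋_N} cos(p_k·x)`
over the centred representatives and apply dominated convergence over `ℤ^d`: pointwise convergence
of the periodic two-point function (`TorusTwoPointLimit`, Griffiths sandwich) and domination by the
uniform exponential decay `⟨σ₀σ_{x̄}⟩_{𝕋_N} ≤ θ^{⌊‖x‖_∞/(R+1)⌋}` (`TorusTwoPointDecay`, modified Simon
inequality), summable. [cite: AizenmanDuminilCopinAnnals2021, arXiv:1912.07973 Prop. 5.2 third item, eq. (FTconv) (p. 17)] -/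
theorem tendsto_twoPointFourierTorus_re (hd : 2 ≤ d) {β : ℝ} (hβ : 0 ≤ β) (hβc : β < criticalBeta d)
    {Nseq : ℕ → ℕ} [∀ j, NeZero (Nseq j)] (hN : Tendsto Nseq atTop atTop)
    (k : ∀ j : ℕ, TorusSite d (Nseq j)) {p : Fin d → ℝ}
    (hk : ∀ i, Tendsto (fun j => latticeMomentum (Nseq j) (k j) i) atTop (𝓝 (p i))) :
    Tendsto (fun j => (twoPointFourierTorus (isingTorusMeasure d (Nseq j) β 0) (k j)).re) atTop
      (𝓝 (twoPointPlusFourier d β p)) := by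
  classical
  -- the uniform decay
  obtain ⟨R, θ, hR1, hθ0, hθ1, hdecay⟩ := exists_uniform_decay_isingTorusTwoPoint hd hβ hβc
  -- `θ' = max θ (1/2) ∈ [1/2, 1)`, and the summable bound
  set θ' : ℝ := max θ (1 / 2) with hθ'
  have hθ'pos : 0 < θ' := lt_max_of_lt_right one_half_pos
  have hθ'1 : θ' < 1 := max_lt hθ1 one_half_lt_one
  have hθθ' : θ ≤ θ' := le_max_left _ _
  set c : ℝ := -Real.log θ' / (R + 1) with hc
  have hcpos : 0 < c := div_pos (neg_pos.2 (Real.log_neg hθ'pos hθ'1)) (by positivity)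
  set bound : Site d → ℝ := fun x => θ'⁻¹ * Real.exp (-c * ‖x‖) with hbound
  have hbound_summ : Summable bound := by
    obtain ⟨B, hB⟩ := sum_box_exp_neg_mul_norm_le (d := d) hcpos
    have hs : Summable fun x : Site d => Real.exp (-c * ‖x‖) := by
      refine summable_of_sum_le (c := B) (fun x => (Real.exp_pos _).le) fun s => ?_
      obtain ⟨N, hN⟩ := exists_forall_subset_box d s
      exact (Finset.sum_le_sum_of_subset_of_nonneg (hN N le_rfl) fun x _ _ => (Real.exp_pos _).le).trans (hB N)
    exact hs.mul_left θ'⁻¹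
  have hpow_le : ∀ x : Site d, θ ^ (Site.supNorm x / (R + 1)) ≤ bound x := by
    intro x
    refine (pow_le_pow_left₀ hθ0 hθθ' _).trans ?_
    have := pow_div_le_inv_mul_exp hθ'pos hθ'1.le (L := R + 1) (by omega) (Site.supNorm x)
    show θ' ^ (Site.supNorm x / (R + 1)) ≤ θ'⁻¹ * Real.exp (-c * ‖x‖)
    rw [Site.norm_eq_supNorm]
    push_cast at this ⊢
    exact this
  -- the terms as functions on `ℤ^d`
  set f : ℕ → Site d → ℝ := fun j x => if x ∈ centredCube d (Nseq j) then
    isingTorusTwoPoint d (Nseq j) β 0 0 (Torus.proj (Nseq j) x) *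
      Real.cos (phase d (latticeMomentum (Nseq j) (k j)) x) else 0 with hf
  have hsum : ∀ j, (twoPointFourierTorus (isingTorusMeasure d (Nseq j) β 0) (k j)).re = ∑' x, f j x := by
    intro j
    rw [twoPointFourierTorus_re_eq_sum_centredCube, tsum_eq_sum (s := centredCube d (Nseq j))]
    · exact Finset.sum_congr rfl fun x hx => by rw [hf]; simp only [if_pos hx]
    · intro x hx; rw [hf]; simp only [if_neg hx]
  simp only [hsum]
  unfold twoPointPlusFourier
  refine tendsto_tsum_of_dominated_convergence hbound_summ (fun x => ?_) ?_
  · -- pointwise convergence at a fixed `x`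
    have hmem : ∀ᶠ j in atTop, x ∈ centredCube d (Nseq j) := by
      filter_upwards [hN.eventually (eventually_gt_atTop (2 * Site.supNorm x))] with j hj
      rw [mem_centredCube]
      intro i
      have := Site.natAbs_le_supNorm x i
      constructor <;> omega
    have hG := tendsto_isingTorusTwoPoint_proj hβ hβc hN x
    have hcos : Tendsto (fun j => Real.cos (phase d (latticeMomentum (Nseq j) (k j)) x)) atTop
        (𝓝 (Real.cos (phase d p x))) := by
      refine (Real.continuous_cos.tendsto _).comp ?_
      unfold phase
      exact tendsto_finsetSum _ fun i _ => (hk i).mul_const _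
    refine (hG.mul hcos).congr' ?_
    filter_upwards [hmem] with j hj
    rw [hf]; simp only [if_pos hj]
  · -- domination, for `N_j ≥ 2R + 4`
    filter_upwards [hN.eventually (eventually_ge_atTop (2 * R + 4))] with j hj x
    rw [hf]
    simp only
    split_ifs with hx
    · have h2 := two_mul_supNorm_le_of_mem_centredCube hx
      obtain ⟨hG0, hGle⟩ := hdecay (Nseq j) hj x h2
      rw [Real.norm_eq_abs, abs_mul, abs_of_nonneg hG0]
      calc _ ≤ isingTorusTwoPoint d (Nseq j) β 0 0 (Torus.proj (Nseq j) x) * 1 :=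
            mul_le_mul_of_nonneg_left (Real.abs_cos_le_one _) hG0
        _ ≤ θ ^ (Site.supNorm x / (R + 1)) := by rw [mul_one]; exact hGle
        _ ≤ bound x := hpow_le x
    · rw [norm_zero]
      exact mul_nonneg (inv_nonneg.2 hθ'pos.le) (Real.exp_pos _).le

end Limit

/-! ### Part 5. Consequences: `Ŝ_β ≥ 0`, the infrared bound, and the monotonicity of ADC Prop. 5.4 (i),(ii) -/

section Consequences

/-- **Invariance under shifts by `2πℤ^d`**: `Ŝ(p') = Ŝ(p)` if `p' - p ∈ 2πℤ^d`. [folklore] -/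
theorem twoPointPlusFourier_eq_of_sub_mem (β : ℝ) {p p' : Fin d → ℝ} (h : ∀ i, ∃ m : ℤ, p' i = p i + m * (2 * Real.pi)) :
    twoPointPlusFourier d β p' = twoPointPlusFourier d β p := by
  choose m hm using h
  unfold twoPointPlusFourier
  refine tsum_congr fun x => ?_
  congr 1
  have : phase d p' x = phase d p x + ((∑ i, m i * x i : ℤ) : ℝ) * (2 * Real.pi) := by
    unfold phase
    push_cast
    simp only [hm, Finset.sum_mul, ← Finset.sum_add_distrib]
    exact Finset.sum_congr rfl fun i _ => by ring
  rw [this, Real.cos_add_int_mul_two_pi]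

/-- The reduction of a momentum to `[0, 2π)^d`. [folklore] -/
def reduceMomentum (p : Fin d → ℝ) : Fin d → ℝ := fun i => p i - ⌊p i / (2 * Real.pi)⌋ * (2 * Real.pi)

/-- The reduced momentum lies in `[0, 2π)^d`. [folklore] -/
theorem reduceMomentum_mem (p : Fin d → ℝ) (i : Fin d) : 0 ≤ reduceMomentum p i ∧ reduceMomentum p i < 2 * Real.pi := by
  unfold reduceMomentum
  have h2π : 0 < 2 * Real.pi := by positivity
  exact ⟨Int.sub_floor_div_mul_nonneg (p i) h2π, Int.sub_floor_div_mul_lt (p i) h2π⟩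

/-- `Ŝ` is unchanged by the reduction. [folklore] -/
theorem twoPointPlusFourier_reduceMomentum (β : ℝ) (p : Fin d → ℝ) :
    twoPointPlusFourier d β (reduceMomentum p) = twoPointPlusFourier d β p :=
  twoPointPlusFourier_eq_of_sub_mem β fun i => ⟨-⌊p i / (2 * Real.pi)⌋, by unfold reduceMomentum; push_cast; ring⟩

/-- Cosines are unchanged by the reduction. [folklore] -/
theorem cos_reduceMomentum (p : Fin d → ℝ) (i : Fin d) : Real.cos (reduceMomentum p i) = Real.cos (p i) := by
  unfold reduceMomentum
  rw [sub_eq_add_neg, ← neg_mul, show -(⌊p i / (2 * Real.pi)⌋ : ℝ) * (2 * Real.pi) =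
    ((-⌊p i / (2 * Real.pi)⌋ : ℤ) : ℝ) * (2 * Real.pi) by push_cast; ring, Real.cos_add_int_mul_two_pi]

/-- **Lattice approximants** of a momentum `q ∈ [0, 2π)`: `κ_N(q) = ⌊qN/(2π)⌋ ∈ {0, …, N-1}` and
`2πκ_N(q)/N → q`. [folklore] -/
def momentumIndex (N : ℕ) (q : ℝ) : ℕ := ⌊q * N / (2 * Real.pi)⌋.toNat

/-- The approximant index is `< N` for `q ∈ [0, 2π)`. [folklore] -/
theorem momentumIndex_lt {N : ℕ} (hN : 0 < N) {q : ℝ} (hq0 : 0 ≤ q) (hq : q < 2 * Real.pi) : momentumIndex N q < N := by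
  unfold momentumIndex
  have h2π : 0 < 2 * Real.pi := by positivity
  have hlt : q * N / (2 * Real.pi) < N := by
    rw [div_lt_iff₀ h2π]
    have : q * N < 2 * Real.pi * N := by
      have hN' : (0 : ℝ) < N := by exact_mod_cast hN
      nlinarith
    linarith
  have hfl : ⌊q * N / (2 * Real.pi)⌋ < N := Int.floor_lt.2 (by exact_mod_cast hlt)
  have h0 : 0 ≤ ⌊q * N / (2 * Real.pi)⌋ := Int.floor_nonneg.2 (by positivity)
  omega

/-- `|2πκ_N(q)/N - q| ≤ 2π/N`. [folklore] -/
theorem abs_momentumIndex_sub_le {N : ℕ} (hN : 0 < N) {q : ℝ} (hq0 : 0 ≤ q) :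
    |2 * Real.pi * (momentumIndex N q : ℝ) / N - q| ≤ 2 * Real.pi / N := by
  unfold momentumIndex
  have h2π : 0 < 2 * Real.pi := by positivity
  have hN' : (0 : ℝ) < N := by exact_mod_cast hN
  have h0 : 0 ≤ ⌊q * N / (2 * Real.pi)⌋ := Int.floor_nonneg.2 (by positivity)
  have hcast : ((⌊q * N / (2 * Real.pi)⌋.toNat : ℕ) : ℝ) = (⌊q * N / (2 * Real.pi)⌋ : ℝ) := by
    have : ((⌊q * N / (2 * Real.pi)⌋.toNat : ℤ)) = ⌊q * N / (2 * Real.pi)⌋ := Int.toNat_of_nonneg h0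
    exact_mod_cast this
  rw [hcast]
  have h1 := Int.floor_le (q * N / (2 * Real.pi))
  have h2 := Int.lt_floor_add_one (q * N / (2 * Real.pi))
  rw [abs_le]
  constructor
  · -- `2π⌊·⌋/N ≥ q - 2π/N`
    have : (q * N / (2 * Real.pi) - 1) * (2 * Real.pi) / N ≤ (⌊q * N / (2 * Real.pi)⌋ : ℝ) * (2 * Real.pi) / N := by
      apply div_le_div_of_nonneg_right _ hN'.le
      nlinarith
    have e : (q * N / (2 * Real.pi) - 1) * (2 * Real.pi) / N = q - 2 * Real.pi / N := by field_simp
    rw [e] at this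
    have e2 : 2 * Real.pi * (⌊q * N / (2 * Real.pi)⌋ : ℝ) / N = (⌊q * N / (2 * Real.pi)⌋ : ℝ) * (2 * Real.pi) / N := by ring
    rw [e2]
    linarith
  · have : (⌊q * N / (2 * Real.pi)⌋ : ℝ) * (2 * Real.pi) / N ≤ (q * N / (2 * Real.pi)) * (2 * Real.pi) / N := by
      apply div_le_div_of_nonneg_right _ hN'.le
      nlinarith
    have e : (q * N / (2 * Real.pi)) * (2 * Real.pi) / N = q := by field_simp
    rw [e] at this
    have e2 : 2 * Real.pi * (⌊q * N / (2 * Real.pi)⌋ : ℝ) / N = (⌊q * N / (2 * Real.pi)⌋ : ℝ) * (2 * Real.pi) / N := by ring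
    rw [e2]
    have : 0 ≤ 2 * Real.pi / N := by positivity
    linarith

/-- The approximating torus momenta of a reduced momentum `p ∈ [0, 2π)^d` along the even tori
`N_j = 2j + 4`. [folklore] -/
def approxMomentum (p : Fin d → ℝ) (j : ℕ) : TorusSite d (2 * j + 4) := fun i => (momentumIndex (2 * j + 4) (p i) : ZMod (2 * j + 4))

/-- The lattice momentum of the approximant. [folklore] -/
theorem latticeMomentum_approxMomentum {p : Fin d → ℝ} (hp : ∀ i, 0 ≤ p i ∧ p i < 2 * Real.pi) (j : ℕ) (i : Fin d) :
    latticeMomentum (2 * j + 4) (approxMomentum p j) i = 2 * Real.pi * (momentumIndex (2 * j + 4) (p i) : ℝ) / (2 * j + 4 : ℕ) := by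
  unfold latticeMomentum approxMomentum
  rw [ZMod.val_natCast, Nat.mod_eq_of_lt (momentumIndex_lt (by omega) (hp i).1 (hp i).2)]

/-- The approximants converge: `2πκ_{N_j}(p_i)/N_j → p_i`. [folklore] -/
theorem tendsto_latticeMomentum_approxMomentum {p : Fin d → ℝ} (hp : ∀ i, 0 ≤ p i ∧ p i < 2 * Real.pi) (i : Fin d) :
    Tendsto (fun j => latticeMomentum (2 * j + 4) (approxMomentum p j) i) atTop (𝓝 (p i)) := by
  simp only [latticeMomentum_approxMomentum hp]
  rw [Metric.tendsto_atTop]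
  intro ε hε
  obtain ⟨j₀, hj₀⟩ := exists_nat_gt (2 * Real.pi / ε)
  refine ⟨j₀, fun j hj => ?_⟩
  rw [Real.dist_eq]
  refine (abs_momentumIndex_sub_le (by omega) (hp i).1).trans_lt ?_
  have hj' : (2 * Real.pi / ε : ℝ) < (2 * j + 4 : ℕ) := by
    have : (j₀ : ℝ) ≤ j := by exact_mod_cast hj
    push_cast
    linarith
  rw [div_lt_iff₀ (by positivity)]
  rw [div_lt_iff₀ hε] at hj'
  linarith

/-- `N_j = 2j + 4 → ∞`. [folklore] -/
theorem tendsto_two_mul_add_four : Tendsto (fun j : ℕ => 2 * j + 4) atTop atTop := by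
  refine tendsto_atTop_mono (fun j => ?_) tendsto_id
  show j ≤ 2 * j + 4
  omega

/-- **`Ŝ_β(p) ≥ 0`** (the positivity of the two-point function's Fourier transform, Aizenman–Duminil-Copin
2021, (5.11) "`≥ 0`"; Fröhlich–Simon–Spencer 1976, §3): for `d ≥ 2`, `0 ≤ β < β_c` and every `p ∈ ℝ^d`.
Limit of the finite-volume positivity `twoPointFourierTorus_re_nonneg` (transfer matrix). [cite: AizenmanDuminilCopinAnnals2021, arXiv:1912.07973 §5.2 eq. (5.11) (p. 17)] -/
theorem twoPointPlusFourier_nonneg {d' : ℕ} (hd : 1 ≤ d') {β : ℝ} (hβ : 0 ≤ β) (hβc : β < criticalBeta (d' + 1))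
    (p : Fin (d' + 1) → ℝ) : 0 ≤ twoPointPlusFourier (d' + 1) β p := by
  rw [← twoPointPlusFourier_reduceMomentum]
  have hp := reduceMomentum_mem p
  have hlim := tendsto_twoPointFourierTorus_re (d := d' + 1) (by omega) hβ hβc tendsto_two_mul_add_four
    (approxMomentum (reduceMomentum p)) (tendsto_latticeMomentum_approxMomentum hp)
  exact ge_of_tendsto' hlim fun j => twoPointFourierTorus_re_nonneg (by omega) hβ 0 _

/-- `dispersion` is invariant under reduction mod `2π`. [folklore] -/
theorem dispersion_reduceMomentum (p : Fin d → ℝ) : dispersion (reduceMomentum p) = dispersion p := by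
  unfold dispersion
  exact Finset.sum_congr rfl fun i _ => by rw [cos_reduceMomentum]

/-- `dispersion` is continuous along the approximants: `ℰ(p_{k_j}) → ℰ(p)`. [folklore] -/
theorem tendsto_dispersion_latticeMomentum {Nseq : ℕ → ℕ} (k : ∀ j : ℕ, TorusSite d (Nseq j))
    {p : Fin d → ℝ} (hk : ∀ i, Tendsto (fun j => latticeMomentum (Nseq j) (k j) i) atTop (𝓝 (p i))) :
    Tendsto (fun j => dispersion (latticeMomentum (Nseq j) (k j))) atTop (𝓝 (dispersion p)) := by
  unfold dispersion
  exact tendsto_finsetSum _ fun i _ => tendsto_const_nhds.sub ((Real.continuous_cos.tendsto _).comp (hk i))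

/-- **The infrared bound in infinite volume** (Fröhlich–Simon–Spencer 1976, Thm 3.1;
Aizenman–Duminil-Copin 2021, (5.12): `ℰ(p) Ŝ_{ρ,β}(p) ≤ 1/(2|J|β)`; here `|J| = 1` per bond
direction as in the tree's `infraredBound`, whose normalisation `Ĝ_L(p) ≤ 1/(2β ∑ᵢ(1 - cos pᵢ))` is
kept): for `d ≥ 2`, `0 < β < β_c` and `p ∉ 2πℤ^d`,
`Ŝ_β(p) ≤ 1 / (2β ∑ᵢ (1 - cos pᵢ))`. Limit of the torus infrared bound (`infraredBound_holds`, even tori)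
along `Re Ĝ_{N_j}(k_j) → Ŝ_β(p)`. [cite: AizenmanDuminilCopinAnnals2021, arXiv:1912.07973 §5.2 eq. (5.12) (p. 17)] [cite: FrohlichSimonSpencer1976, Thm. 3.1] -/
theorem twoPointPlusFourier_le_infrared {d' : ℕ} (hd : 1 ≤ d') {β : ℝ} (hβ : 0 < β) (hβc : β < criticalBeta (d' + 1))
    {p : Fin (d' + 1) → ℝ} (hp : 0 < dispersion p) :
    twoPointPlusFourier (d' + 1) β p ≤ 1 / (2 * β * dispersion p) := by
  rw [← twoPointPlusFourier_reduceMomentum, ← dispersion_reduceMomentum]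
  rw [← dispersion_reduceMomentum] at hp
  set q := reduceMomentum p with hq
  have hqmem := reduceMomentum_mem p
  have hk := tendsto_latticeMomentum_approxMomentum hqmem
  have hlim := tendsto_twoPointFourierTorus_re (d := d' + 1) (by omega) hβ.le hβc tendsto_two_mul_add_four
    (approxMomentum q) hk
  have hdisp := tendsto_dispersion_latticeMomentum (approxMomentum q) hk
  have hrhs : Tendsto (fun j => 1 / (2 * β * dispersion (latticeMomentum (2 * j + 4) (approxMomentum q j)))) atTop
      (𝓝 (1 / (2 * β * dispersion q))) :=
    tendsto_const_nhds.div (hdisp.const_mul (2 * β)) (by positivity)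
  refine le_of_tendsto_of_tendsto hlim hrhs ?_
  -- eventually `ℰ(p_{k_j}) > 0`, so `k_j ≠ 0` and the torus infrared bound applies
  filter_upwards [hdisp.eventually (lt_mem_nhds hp)] with j hj
  have hk0 : approxMomentum q j ≠ 0 := by
    intro h0
    rw [h0] at hj
    have : dispersion (latticeMomentum (2 * j + 4) (0 : TorusSite (d' + 1) (2 * j + 4))) = 0 := by
      unfold dispersion latticeMomentum
      simp
    rw [this] at hj
    exact lt_irrefl _ hj
  exact infraredBound_holds (d := d' + 1) (L := 2 * j + 4) ⟨j + 2, by ring⟩ (by omega) hβ (approxMomentum q j) hk0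

/-- Reduction commutes with updating one coordinate. [folklore] -/
theorem reduceMomentum_update (p : Fin d → ℝ) (i : Fin d) (q : ℝ) :
    reduceMomentum (Function.update p i q) = Function.update (reduceMomentum p) i (q - ⌊q / (2 * Real.pi)⌋ * (2 * Real.pi)) := by
  funext j
  unfold reduceMomentum
  by_cases h : j = i
  · subst h; simp
  · simp [Function.update_of_ne h]

/-- The approximants of an updated momentum. [folklore] -/
theorem approxMomentum_update (p : Fin d → ℝ) (i : Fin d) (q : ℝ) (j : ℕ) :
    approxMomentum (Function.update p i q) j = Function.update (approxMomentum p j) i (momentumIndex (2 * j + 4) q : ZMod (2 * j + 4)) := by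
  funext l
  unfold approxMomentum
  by_cases h : l = i
  · subst h; simp
  · simp [Function.update_of_ne h]

/-- `cos q = cos q'` forces `Ŝ(…, q, …) = Ŝ(…, q', …)` (evenness and periodicity in the coordinate). [folklore] -/
theorem twoPointPlusFourier_update_eq_of_cos_eq (β : ℝ) (p : Fin d → ℝ) (i : Fin d) {q : ℝ}
    (h : Real.cos q = Real.cos (p i)) :
    twoPointPlusFourier d β (Function.update p i q) = twoPointPlusFourier d β p := by
  obtain ⟨m, hm | hm⟩ := Real.cos_eq_cos_iff.1 h.symm
  · -- `q = 2mπ + p i`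
    refine twoPointPlusFourier_eq_of_sub_mem β fun j => ?_
    by_cases hj : j = i
    · subst hj; exact ⟨m, by rw [Function.update_self, hm]; ring⟩
    · exact ⟨0, by rw [Function.update_of_ne hj]; simp⟩
  · -- `q = 2mπ - p i`
    have h1 : twoPointPlusFourier d β (Function.update p i q) =
        twoPointPlusFourier d β (Function.update p i (-p i)) := by
      refine twoPointPlusFourier_eq_of_sub_mem β fun j => ?_
      by_cases hj : j = i
      · subst hj; exact ⟨m, by rw [Function.update_self, Function.update_self, hm]; ring⟩
      · exact ⟨0, by rw [Function.update_of_ne hj, Function.update_of_ne hj]; simp⟩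
    rw [h1, twoPointPlusFourier_update_neg]

/-- **ADC Prop. 5.4 (i) in infinite volume: `Ŝ_β(p)` is decreasing in each `|p_i|`** (Glimm–Jaffe
1973; Aizenman–Duminil-Copin 2021, Prop. 5.4 first item; Panis 2023, Cor. 3.15 (i)): for `d ≥ 2`,
`0 ≤ β < β_c`, every `p`, coordinate `i` and `q` with `cos q ≤ cos p_i` (i.e. `|q| ≥ |p_i|` modulo
`2π`), `Ŝ_β(p₁,…,q,…,p_d) ≤ Ŝ_β(p)`. Limit of the exact torus statement
`twoPointFourierTorus_re_le_of_cos_le` (transfer matrix) along `Re Ĝ_{N_j} → Ŝ_β`; the boundary case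
`cos q = cos p_i` is the symmetry `twoPointPlusFourier_update_eq_of_cos_eq`.
[cite: AizenmanDuminilCopinAnnals2021, arXiv:1912.07973 Prop. 5.4 (i) (p. 18)] [cite: Panis2023Triviality, Cor. 3.15 (i)] -/
theorem twoPointPlusFourier_update_le_of_cos_le {d' : ℕ} (hd : 1 ≤ d') {β : ℝ} (hβ : 0 ≤ β)
    (hβc : β < criticalBeta (d' + 1)) (p : Fin (d' + 1) → ℝ) (i : Fin (d' + 1)) {q : ℝ}
    (hcos : Real.cos q ≤ Real.cos (p i)) :
    twoPointPlusFourier (d' + 1) β (Function.update p i q) ≤ twoPointPlusFourier (d' + 1) β p := by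
  rcases hcos.lt_or_eq with hlt | heq
  · -- strict case: pass the torus inequality to the limit
    rw [← twoPointPlusFourier_reduceMomentum β p, ← twoPointPlusFourier_reduceMomentum β (Function.update p i q),
      reduceMomentum_update]
    set pr := reduceMomentum p with hpr
    set qr := q - ⌊q / (2 * Real.pi)⌋ * (2 * Real.pi) with hqr
    have hprmem := reduceMomentum_mem p
    have hqrmem : 0 ≤ qr ∧ qr < 2 * Real.pi :=
      ⟨Int.sub_floor_div_mul_nonneg q (by positivity), Int.sub_floor_div_mul_lt q (by positivity)⟩
    have hpr'mem : ∀ l, 0 ≤ Function.update pr i qr l ∧ Function.update pr i qr l < 2 * Real.pi := by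
      intro l
      by_cases hl : l = i
      · subst hl; simpa using hqrmem
      · rw [Function.update_of_ne hl]; exact hprmem l
    have hk := tendsto_latticeMomentum_approxMomentum hprmem
    have hk' := tendsto_latticeMomentum_approxMomentum hpr'mem
    have hlim := tendsto_twoPointFourierTorus_re (d := d' + 1) (by omega) hβ hβc tendsto_two_mul_add_four
      (approxMomentum pr) hk
    have hlim' := tendsto_twoPointFourierTorus_re (d := d' + 1) (by omega) hβ hβc tendsto_two_mul_add_four
      (approxMomentum (Function.update pr i qr)) hk'
    refine le_of_tendsto_of_tendsto hlim' hlim ?_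
    -- eventually `cos p'_{k,i} ≤ cos p_{k,i}`
    have hc' : Tendsto (fun j => Real.cos (latticeMomentum (2 * j + 4) (approxMomentum (Function.update pr i qr) j) i))
        atTop (𝓝 (Real.cos q)) := by
      have := (Real.continuous_cos.tendsto _).comp (hk' i)
      rw [Function.update_self] at this
      have hqq : Real.cos qr = Real.cos q := by
        rw [hqr, sub_eq_add_neg, ← neg_mul, show -(⌊q / (2 * Real.pi)⌋ : ℝ) * (2 * Real.pi) =
          ((-⌊q / (2 * Real.pi)⌋ : ℤ) : ℝ) * (2 * Real.pi) by push_cast; ring, Real.cos_add_int_mul_two_pi]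
      rwa [hqq] at this
    have hc : Tendsto (fun j => Real.cos (latticeMomentum (2 * j + 4) (approxMomentum pr j) i))
        atTop (𝓝 (Real.cos (p i))) := by
      have := (Real.continuous_cos.tendsto _).comp (hk i)
      rw [cos_reduceMomentum] at this
      exact this
    filter_upwards [hc'.eventually_lt hc hlt] with j hj
    refine twoPointFourierTorus_re_le_of_cos_le (by omega) hβ 0 i ?_ ?_
    · rw [approxMomentum_update]
      simp [Fin.removeNth_update]
    · unfold latticeMomentum at hj
      exact hj.le
  · rw [twoPointPlusFourier_update_eq_of_cos_eq β p i heq]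

/-- **ADC Prop. 5.4 (ii) in infinite volume: `ℰ₁(p_i) Ŝ_β(p)` is increasing in `|p_i|`**
(Aizenman–Duminil-Copin 2021, Prop. 5.4 second item; Panis 2023, Cor. 3.15 (ii)), `ℰ₁(p_i) = 2(1 - cos p_i)`:
for `d ≥ 2`, `0 ≤ β < β_c`, every `p`, coordinate `i` and `q` with `cos q ≤ cos p_i`,
`(1 - cos p_i) Ŝ_β(p) ≤ (1 - cos q) Ŝ_β(p₁,…,q,…,p_d)`. Limit of the exact torus statement
`one_sub_cos_mul_twoPointFourierTorus_re_le`. [cite: AizenmanDuminilCopinAnnals2021, arXiv:1912.07973 Prop. 5.4 (ii) (p. 18)] [cite: Panis2023Triviality, Cor. 3.15 (ii)] -/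
theorem one_sub_cos_mul_twoPointPlusFourier_le {d' : ℕ} (hd : 1 ≤ d') {β : ℝ} (hβ : 0 ≤ β)
    (hβc : β < criticalBeta (d' + 1)) (p : Fin (d' + 1) → ℝ) (i : Fin (d' + 1)) {q : ℝ}
    (hcos : Real.cos q ≤ Real.cos (p i)) :
    (1 - Real.cos (p i)) * twoPointPlusFourier (d' + 1) β p ≤
      (1 - Real.cos q) * twoPointPlusFourier (d' + 1) β (Function.update p i q) := by
  rcases hcos.lt_or_eq with hlt | heq
  · rw [← twoPointPlusFourier_reduceMomentum β p, ← twoPointPlusFourier_reduceMomentum β (Function.update p i q),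
      reduceMomentum_update]
    set pr := reduceMomentum p with hpr
    set qr := q - ⌊q / (2 * Real.pi)⌋ * (2 * Real.pi) with hqr
    have hprmem := reduceMomentum_mem p
    have hqrmem : 0 ≤ qr ∧ qr < 2 * Real.pi :=
      ⟨Int.sub_floor_div_mul_nonneg q (by positivity), Int.sub_floor_div_mul_lt q (by positivity)⟩
    have hpr'mem : ∀ l, 0 ≤ Function.update pr i qr l ∧ Function.update pr i qr l < 2 * Real.pi := by
      intro l
      by_cases hl : l = i
      · subst hl; simpa using hqrmem
      · rw [Function.update_of_ne hl]; exact hprmem l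
    have hk := tendsto_latticeMomentum_approxMomentum hprmem
    have hk' := tendsto_latticeMomentum_approxMomentum hpr'mem
    have hlim := tendsto_twoPointFourierTorus_re (d := d' + 1) (by omega) hβ hβc tendsto_two_mul_add_four
      (approxMomentum pr) hk
    have hlim' := tendsto_twoPointFourierTorus_re (d := d' + 1) (by omega) hβ hβc tendsto_two_mul_add_four
      (approxMomentum (Function.update pr i qr)) hk'
    have hc' : Tendsto (fun j => Real.cos (latticeMomentum (2 * j + 4) (approxMomentum (Function.update pr i qr) j) i))
        atTop (𝓝 (Real.cos q)) := by
      have := (Real.continuous_cos.tendsto _).comp (hk' i)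
      rw [Function.update_self] at this
      have hqq : Real.cos qr = Real.cos q := by
        rw [hqr, sub_eq_add_neg, ← neg_mul, show -(⌊q / (2 * Real.pi)⌋ : ℝ) * (2 * Real.pi) =
          ((-⌊q / (2 * Real.pi)⌋ : ℤ) : ℝ) * (2 * Real.pi) by push_cast; ring, Real.cos_add_int_mul_two_pi]
      rwa [hqq] at this
    have hc : Tendsto (fun j => Real.cos (latticeMomentum (2 * j + 4) (approxMomentum pr j) i))
        atTop (𝓝 (Real.cos (p i))) := by
      have := (Real.continuous_cos.tendsto _).comp (hk i)
      rw [cos_reduceMomentum] at this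
      exact this
    refine le_of_tendsto_of_tendsto ((tendsto_const_nhds.sub hc).mul hlim) ((tendsto_const_nhds.sub hc').mul hlim') ?_
    filter_upwards [hc'.eventually_lt hc hlt] with j hj
    have key := one_sub_cos_mul_twoPointFourierTorus_re_le (N := 2 * j + 4) (by omega) hβ 0 i
      (k := approxMomentum pr j) (k' := approxMomentum (Function.update pr i qr) j) ?_ ?_
    · unfold latticeMomentum
      exact key
    · rw [approxMomentum_update]
      simp [Fin.removeNth_update]
    · unfold latticeMomentum at hj
      exact hj.le
  · rw [twoPointPlusFourier_update_eq_of_cos_eq β p i heq, heq]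

end Consequences

end Literature.Probability.LatticeModels

end
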